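import Literature.AnabelianGeometry.EtaleTheta.Discharge.Sec4BaseEquivOfTemperoids
import Literature.AnabelianGeometry.SemiGraphs.ConnectedPartEquivExtension
import Literature.AnabelianGeometry.EtaleTheta.FrobenioidThetaOfBiKummerData

/-!
# [EtTh] Thm. 5.6 proof, T56-L02: «hence [cf. [SemiAnbd] Prop. 3.2] an outer automorphism of the tempered fundamental
# group» — the base transport INDUCED by a self-equivalence of `B^temp(Π^tp_X)⁰` is the shadow of an automorphism of `Π^tp_X`

S. Mochizuki, *The étale theta function and its Frobenioid-theoretic manifestations*, Publ. RIMS **45** (2009)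
[MochizukiEtTh2009], Thm. 5.6 proof p.328 (PDF p.102) l.−2 – p.329 l.1: an automorphism `Ψ` of the tempered Frobenioid
induces a self-equivalence `Ψ^bs` of the base category, «hence [cf. [SemiAnbd] Prop. 3.2] an outer automorphism of the
tempered fundamental group of the smooth log orbicurve in question»; S. Mochizuki, *Semi-graphs of anabelioids*
[MochizukiSemiAnbd2006], Prop. 3.2 p.35, Rmk. 3.1.5 p.34.

abc-iut cell, layer L2 (seat abc-iut-w5-d013 gen 3), ROW «SUBDAG-EtTh-Thm56 T56-L02 AT `B^temp(Π)⁰`» (SUBDAG-EtTh-Thm56.md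
row T56-L02: «NOT TYPED (L3 statement) — enters T56-L03/L09c only through the induced base transport `θ` and `aΨ`»; the
binders `γ`, `hγ : θ_Ψ (ρ y) = ρ (γ y)` of gen 2's `Thm56Sub.deltaTransportCompat_ofBiKummerData` (p420747), of
abc-iut-w5-d020's `cyclotomicRigidityPreserved_ofBiKummerData` (p421202) and of abc-iut-w5-d245's `hYdd` reduction
(p424854)).  RESULTS (proof-only, no definition):
* `GaloisObjects.exists_conj_of_induced_connectedPart` — **T56-L02 typed and PROVED**: for a self-equivalence `E₀` of
  `B^temp(Π)⁰ = ConnectedPart (BTemp Π)` (`Π` tempered, Galois-countable), a Galois object `B`, a homomorphism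
  `ρ_B : Π → Aut(B)` lying over the temperoid's `galoisSurjOf`, and ANY map `θ : Aut(B) → Aut(B)` INDUCED by `E₀` and an
  identification `i : E₀(B) ≅ B` (`(θ σ) = i⁻¹ ∘ E₀(σ) ∘ i`), there are a topological-group AUTOMORPHISM `ψ` of `Π` and
  `c ∈ Π` with `θ(ρ_B(k)) = ρ_B(c·ψ(k)·c⁻¹)` for all `k` — via `BTemp.exists_equivalence_extension` (extension of `E₀` to
  the temperoid) + `BTemp.exists_res_iso_of_equivalence` ([SemiAnbd] Prop. 3.2: `≅ B^temp(φ)`, `ψ = φ⁻¹`) + gen 2's transport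
  lemmas; `GaloisObjects.exists_induced_autEquiv` — the induced transport exists (non-vacuity of the hypothesis, v2);
* `ThetaFrobenioid.exists_galoisShadow_of_induced` — the §5 corollary: for a bi-Kummer setting `S` over
  `ConnectedPart (BTemp X.Pi)` with the temperoid's Galois data (abc-iut-L2-t4's `mkOfConnectedTemperoid`: hypotheses
  `⟨hA, fun _ => rfl⟩` / `id`), an `N`-th root `R`, `ιX : Π ≃ Π^tp_X`, and any `θ_Ψ : Aut_D(B_N^bs) ≃* Aut_D(B_N^bs)`
  INDUCED by a self-equivalence `E₀` of the base and `i : E₀(B_N^bs) ≅ B_N^bs` (print: induced by `Ψ^bs` and `β^bs`), there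
  is `γ : Π ≃ₜ* Π` with `θ_Ψ (ρ y) = ρ (γ y)` for all `y` (`ρ = rhoOfBiKummerData R ιX`) — the binder pair `(γ, hγ)`.
HONEST SCOPE: `θ_Ψ` must be of the printed, INDUCED form (hypothesis `hθ`); for a bare `θ_Ψ` (as the consumer files bind
it) nothing is claimed.  Nothing here bears on [IUTchIII] Cor. 3.12 (refereed pre-IUT material); typed ≠ proved except
for the theorems of this file.
-/

noncomputable section

open CategoryTheory Topology

namespace Literature.AnabelianGeometry.SemiGraphs

namespace GaloisObjects

open Literature.AlgebraicGeometry.Frobenioids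
open Literature.AlgebraicGeometry.Frobenioids.QuasiTemperoid.BTempConnected

universe u

variable {G : Type u} [Group G] [TopologicalSpace G] [IsTopologicalGroup G] [SecondCountableTopology G]

/-- **[EtTh] Thm. 5.6, T56-L02 («hence [cf. [SemiAnbd] Prop. 3.2] an outer automorphism of the tempered fundamental
group»), typed and PROVED at `B^temp(Π)⁰`**: let `E₀` be a self-equivalence of `ConnectedPart (BTemp Π)`, `B` a Galois
object, `ρ_B : Π → Aut(B)` a homomorphism lying over the temperoid's Galois surjection `galoisSurjOf_B`, and
`θ : Aut(B) → Aut(B)` the transport INDUCED by `E₀` and an identification `i : E₀(B) ≅ B`.  Then `θ(ρ_B(k)) =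
ρ_B(c·ψ(k)·c⁻¹)` for an automorphism `ψ` of the topological group `Π`, some `c ∈ Π`, and all `k ∈ Π`.
[cite: MochizukiEtTh2009, Thm 5.6 proof p.328 (PDF p.102)] -/
theorem exists_conj_of_induced_connectedPart (hG : IsTempered G)
    (E₀ : ConnectedPart (BTemp G) ≌ ConnectedPart (BTemp G)) (B : ConnectedPart (BTemp G)) (hB : IsGaloisObj B.obj)
    (ρB : G →* Aut B) (hρ : ∀ k : G, (ρB k).hom.hom = (galoisSurjOf hG B.obj hB k).hom)
    (i : E₀.functor.obj B ≅ B) (θ : Aut B → Aut B)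
    (hθ : ∀ σ : Aut B, (θ σ).hom = i.inv ≫ E₀.functor.map σ.hom ≫ i.hom) :
    ∃ (ψ : G ≃ₜ* G) (c : G), ∀ k : G, θ (ρB k) = ρB (c * ψ k * c⁻¹) := by
  -- extend `E₀` to the temperoid and pin the extension to `B^temp(φ)` ([SemiAnbd] Prop. 3.2)
  obtain ⟨E, ⟨ηE⟩⟩ := BTemp.exists_equivalence_extension E₀
  obtain ⟨φ, ψ, hψφ, hφψ, ⟨iφ⟩, -⟩ := BTemp.exists_res_iso_of_equivalence hG hG E
  have hφ : Function.Surjective φ := fun x => ⟨ψ x, hφψ x⟩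
  let η : E₀.functor ⋙ (connectedObjects (BTemp G)).ι ≅ (connectedObjects (BTemp G)).ι ⋙ BTemp.res φ :=
    ηE ≪≫ Functor.isoWhiskerLeft (connectedObjects (BTemp G)).ι iφ
  -- the component at `B`, with objectwise types, and its naturality on endomorphisms of `B`
  obtain ⟨ηB, hn⟩ : ∃ ηB : (E₀.functor.obj B).obj ≅ (BTemp.res φ).obj B.obj,
      ∀ f : B ⟶ B, (E₀.functor.map f).hom ≫ ηB.hom = ηB.hom ≫ (BTemp.res φ).map f.hom :=
    ⟨η.app B, fun f => η.hom.naturality f⟩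
  let e : (BTemp.res φ).obj B.obj ≅ B.obj := ηB.symm ≪≫ (connectedObjects (BTemp G)).ι.mapIso i
  have he_inv : e.inv = i.inv.hom ≫ ηB.hom := rfl
  have he_hom : e.hom = ηB.inv ≫ i.hom.hom := rfl
  obtain ⟨c₁, hc₁⟩ := galoisSurjOf_res hG hG φ hφ B.obj hB
  obtain ⟨c₂, hc₂⟩ := galoisSurjOf_iso_conj hG e (isGaloisObj_res hG φ hφ B.obj hB) hB
  let Ψ : G ≃ₜ* G :=
    { toFun := ψ, invFun := φ, left_inv := hφψ, right_inv := hψφ, map_mul' := fun x y => map_mul ψ x y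
      continuous_toFun := ψ.continuous, continuous_invFun := φ.continuous }
  refine ⟨Ψ, c₂ * c₁, fun k => ?_⟩
  apply Iso.ext
  apply ObjectProperty.hom_ext _ ?_
  have hnat : (E₀.functor.map (ρB k).hom).hom = ηB.hom ≫ (BTemp.res φ).map (ρB k).hom.hom ≫ ηB.inv := by
    rw [← Category.assoc, ← hn, Category.assoc, ηB.hom_inv_id, Category.comp_id]
  have h1 := hc₁ (ψ k)
  rw [hφψ] at h1
  have h2 := hc₂ (c₁ * ψ k * c₁⁻¹)
  rw [show c₂ * (c₁ * ψ k * c₁⁻¹) * c₂⁻¹ = c₂ * c₁ * ψ k * (c₂ * c₁)⁻¹ by group, he_inv, he_hom] at h2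
  change (θ (ρB k)).hom.hom = (ρB (c₂ * c₁ * Ψ k * (c₂ * c₁)⁻¹)).hom.hom
  rw [hθ, ObjectProperty.FullSubcategory.comp_hom, ObjectProperty.FullSubcategory.comp_hom, hnat, hρ, hρ, h1]
  change i.inv.hom ≫ (ηB.hom ≫ (galoisSurjOf hG ((BTemp.res φ).obj B.obj) _ (c₁ * ψ k * c₁⁻¹)).hom ≫ ηB.inv) ≫
      i.hom.hom = (galoisSurjOf hG B.obj hB (c₂ * c₁ * ψ k * (c₂ * c₁)⁻¹)).hom
  rw [← h2]
  simp only [Category.assoc]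

omit [IsTopologicalGroup G] [SecondCountableTopology G] in
/-- **The hypothesis `hθ` above is satisfiable (non-vacuity of the INDUCED form):** the transport induced by a
self-equivalence `E₀` of `B^temp(Π)⁰` and an identification `i : E₀(B) ≅ B`, `σ ↦ i⁻¹ ∘ E₀(σ) ∘ i`, exists as a group
automorphism of `Aut(B)` (`E₀` is fully faithful) — print's «the isomorphism `Aut_D(B^bs) ⥲ Aut_D(B^bs)` induced by `Ψ^bs`».
[cite: MochizukiEtTh2009, Thm 5.6 proof p.328 (PDF p.102)] -/
theorem exists_induced_autEquiv (E₀ : ConnectedPart (BTemp G) ≌ ConnectedPart (BTemp G)) (B : ConnectedPart (BTemp G))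
    (i : E₀.functor.obj B ≅ B) :
    ∃ θ : Aut B ≃* Aut B, ∀ σ : Aut B, (θ σ).hom = i.inv ≫ E₀.functor.map σ.hom ≫ i.hom :=
  ⟨((Functor.FullyFaithful.ofFullyFaithful E₀.functor).autMulEquivOfFullyFaithful B).trans (Aut.autMulEquivOfIso i),
    fun _ => rfl⟩

end GaloisObjects

end Literature.AnabelianGeometry.SemiGraphs

/-! ### The §5 corollary: the binders `γ`, `hγ` for an INDUCED `θ_Ψ` -/

namespace Literature.AnabelianGeometry.EtaleTheta

open CategoryTheory Opposite Literature.AlgebraicGeometry.Frobenioids Literature.AnabelianGeometry.SemiGraphs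
  Literature.AnabelianGeometry.SemiGraphs.GaloisObjects

namespace ThetaFrobenioid

universe u₀ v₀ w

variable {K : Type u₀} [Field K] {X : SemiGraphs.TemperedArithmeticGroup.{u₀} K} {D₀ : Type u₀} [Category.{v₀} D₀]
  {V : FrdIMonoidStub.{w}} {T₀ : RealifiedDivisorMonoids (D₀ := D₀) V}
  {VD : FrdICatStub.{u₀ + 1, u₀, w} (ConnectedPart (BTemp X.Pi))}
  {S : BiKummerSetting X T₀ (ConnectedPart (BTemp X.Pi)) VD}
  {pullFrac : ∀ {A A' : S.C} (_ : A' ⟶ A), S.biratUnits A → S.biratUnits A'}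
  {lv N : ℕ+} {T : ThetaEnvData.{max u₀ w} N} {θ : S.biratUnits S.Aodot} {Bl : S.C}
  {Pl : S.FractionPair θ Bl} {Rl : S.NthRoot θ Pl lv pullFrac}

/-- **The binders `(γ, hγ)` of [EtTh] Thm. 5.6 at the §5 data over `B^temp(Π^tp_X)⁰`, DISCHARGED for every INDUCED `θ_Ψ`**
(T56-L02 «hence … an outer automorphism of the tempered fundamental group», p.328, read on `Aut_D(B_N^bs)` through
`ρ : Π ↠ Aut_D(B_N^bs)` of §5 p.331): for a setting over `ConnectedPart (BTemp X.Pi)` whose Galois data are the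
temperoid's (`hg`, `hI` — definitional for abc-iut-L2-t4's `mkOfConnectedTemperoid`), an `N`-th root `R`,
`ιX : Π ≃ Π^tp_X`, a self-equivalence `E₀` of the base with an identification `i : E₀(B_N^bs) ≅ B_N^bs`, and ANY
`θ_Ψ : Aut_D(B_N^bs) ≃* Aut_D(B_N^bs)` induced by them (`θ_Ψ σ = i⁻¹ ∘ E₀(σ) ∘ i`), there is an automorphism `γ` of the
topological group `Π` with `θ_Ψ(ρ y) = ρ(γ y)` for all `y` — `γ := ιX⁻¹ ∘ Inn ∘ ψ ∘ Inn ∘ ιX` for the [SemiAnbd] Prop. 3.2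
automorphism `ψ` of `Π^tp_X`. [cite: MochizukiEtTh2009, Thm 5.6 proof p.328–329 (PDF pp.102–103)] -/
theorem exists_galoisShadow_of_induced
    (hg : ∀ (A : ConnectedPart (BTemp X.Pi)) (hA : S.IsGaloisObj A), ∃ hA' : SemiGraphs.IsGaloisObj A.obj,
      ∀ g : X.Pi, (S.galoisSurj A hA g).hom.hom = (galoisSurjOf X.isTempered A.obj hA' g).hom)
    (hI : ∀ A : ConnectedPart (BTemp X.Pi), SemiGraphs.IsGaloisObj A.obj → S.IsGaloisObj A)
    (R : S.NthRoot Rl.root Rl.pair N pullFrac) (ιX : T.PiX ≃ₜ* X.Pi)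
    (E₀ : ConnectedPart (BTemp X.Pi) ≌ ConnectedPart (BTemp X.Pi)) (i : E₀.functor.obj R.BN.base ≅ R.BN.base)
    (θΨ : Aut R.BN.base ≃* Aut R.BN.base)
    (hθ : ∀ σ : Aut R.BN.base, (θΨ σ).hom = i.inv ≫ E₀.functor.map σ.hom ≫ i.hom) :
    ∃ γ : T.PiX ≃ₜ* T.PiX, ∀ y : T.PiX, θΨ (rhoOfBiKummerData R ιX y) = rhoOfBiKummerData R ιX (γ y) := by
  haveI := X.secondCountableTopology
  -- conjugation `x ↦ c x c⁻¹` as a continuous automorphism of `Π^tp_X`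
  let conjEquiv : X.Pi → (X.Pi ≃ₜ* X.Pi) := fun c =>
    { MulAut.conj c with
      continuous_toFun := by
        change Continuous fun x => c * x * c⁻¹
        fun_prop
      continuous_invFun := by
        change Continuous fun x => c⁻¹ * x * c
        fun_prop }
  have conjEquiv_apply : ∀ c x : X.Pi, conjEquiv c x = c * x * c⁻¹ := fun _ _ => rfl
  -- Galois data of `A_N^bs`, `B_N^bs` read in the temperoid
  obtain ⟨hA', eA⟩ := hg R.AN.base R.αData.isGalois
  have hBobj : SemiGraphs.IsGaloisObj R.BN.base.obj :=
    isGaloisObj_of_iso X.isTempered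
      ((connectedObjects (BTemp X.Pi)).ι.mapIso (BiKummerSetting.NthRoot.baseIso S R)).symm hA'
  have hBN : S.IsGaloisObj R.BN.base := hI _ hBobj
  obtain ⟨hB', eB⟩ := hg R.BN.base hBN
  -- (1) `ρ y = galoisSurj_{B_N}(c₀ · ιX y · c₀⁻¹)`: naturality of the Galois surjections along `(s^⊓_N)^bs : A_N^bs ⥲ B_N^bs`
  obtain ⟨c, hc⟩ := galoisSurjOf_iso_conj X.isTempered
    ((connectedObjects (BTemp X.Pi)).ι.mapIso (BiKummerSetting.NthRoot.baseIso S R)) hA' hB'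
  have hρ : ∀ g : X.Pi, (BiKummerSetting.NthRoot.baseIso S R).conjAut (S.galoisSurj R.AN.base R.αData.isGalois g) =
      S.galoisSurj R.BN.base hBN (c * g * c⁻¹) := by
    intro g
    apply Iso.ext
    apply ObjectProperty.hom_ext _ ?_
    rw [Iso.conjAut_hom, Iso.conj_apply, ObjectProperty.FullSubcategory.comp_hom,
      ObjectProperty.FullSubcategory.comp_hom, eA, eB]
    exact hc g
  -- (2) T56-L02 at `B_N^bs` for the induced `θ_Ψ`
  obtain ⟨ψ, c', hψ⟩ := exists_conj_of_induced_connectedPart X.isTempered E₀ R.BN.base hB'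
    (S.galoisSurj R.BN.base hBN) eB i θΨ hθ
  -- (3) assemble `γ := ιX⁻¹ ∘ Inn(c⁻¹ c') ∘ ψ ∘ Inn(c) ∘ ιX`
  refine ⟨(((ιX.trans (conjEquiv c)).trans ψ).trans (conjEquiv (c⁻¹ * c'))).trans ιX.symm, fun y => ?_⟩
  rw [rhoOfBiKummerData_apply, rhoOfBiKummerData_apply, hρ, hρ, hψ]
  simp only [ContinuousMulEquiv.trans_apply, conjEquiv_apply, ContinuousMulEquiv.apply_symm_apply]
  congr 1
  group

end ThetaFrobenioid

end Literature.AnabelianGeometry.EtaleTheta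

end
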